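import Summits.Ventures.PercRepro.RankLevelSetH
import Summits.Ventures.PercRepro.PlaneCore

/-!
# PercRepro — the per-flat transfer: any flat weighting with the per-flat inequality gives C-025's core (p2, gen 5)

Theorems N (`PairWeighting.lean`, lines) and O (`PlaneWeighting.lean` / `PerPlaneClosing.lean`, planes) prove the rank
level-set inequality by charging every middle-rank set `S` to the rank-`q` flats through a weighting `w(G, S)` with
`Σ_G w(G, S) ≤ 1`, and closing per flat.  This file isolates that transfer step for an ARBITRARY weighting of the
rank-`q` flats (the "existence form" of a per-flat certificate, `CONJECTURES.md` C-027 after `MINE2-RLS.md` §18.3):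

* `Yq M p q` = subsets of the ground set of rank strictly between `q` and `p`, `Uq M p q` = rank-`q` subsets whose
  complement has rank `p` (the bottom sets of `C025` at `(p, q)`, by complementation), `flatsQ M q` = the rank-`q`
  flats, `UqG M p q G` = the bottom sets inside the flat `G`;
* `flatsQ_two` / `flatsQ_three`: at `q = 2, 3` the flats are the `lines` / `planes` of the Theorem N / O files;
* `card_Uq_le`: every bottom set lies in its closure, a rank-`q` flat, so `#Uq ≤ Σ_G #UqG(G)`;
* `mul_card_Uq_le_of_perFlat`: if `w ≥ 0`, `Σ_{G ∈ flatsQ} w G S ≤ 1` for every `S ∈ Yq`, and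
  `c · #UqG(G) ≤ Σ_{S ∈ Yq} w G S` for every rank-`q` flat `G`, then `c · #Uq ≤ #Yq`;
* `c025_of_perFlat`: the same conclusion in the set-builder spelling of `C025`;
* `sum_normalized_le_one`, `c025_of_perFlat_normalized`: for a NORMALIZED rule `f G S / Σ_{G'} f G' S` (soft max-trace,
  `θ`-window, …) the hypothesis `Σ_G w ≤ 1` is automatic — only the per-flat inequality remains.

No weighting is constructed here; the file is the plug for whatever per-flat rule survives (`MINE2-RLS.md` §18).
-/

namespace PercRepro

open Finset

namespace PerFlat

open ThmH

variable {α : Type*} [DecidableEq α] (M : Matroid α) [M.Finite]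

open scoped Classical in
/-- The middle level at `(p, q)`: subsets of the ground set with `q < ρ < p`. -/
noncomputable def Yq (p q : ℕ) : Finset (Finset α) :=
  (gr M).powerset.filter (fun S => (q : ℕ∞) < M.eRk (S : Set α) ∧ M.eRk (S : Set α) < (p : ℕ∞))

open scoped Classical in
/-- The bottom sets at `(p, q)`: rank-`q` subsets of the ground set whose complement has rank `p`. -/
noncomputable def Uq (p q : ℕ) : Finset (Finset α) :=
  (gr M).powerset.filter (fun B => M.eRk (B : Set α) = (q : ℕ∞) ∧ M.eRk ((gr M \ B : Finset α) : Set α) = (p : ℕ∞))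

open scoped Classical in
/-- The rank-`q` flats of `M`, as finsets of the ground set. -/
noncomputable def flatsQ (q : ℕ) : Finset (Finset α) :=
  (gr M).powerset.filter (fun G => M.IsFlat (G : Set α) ∧ M.eRk (G : Set α) = (q : ℕ∞))

open scoped Classical in
/-- The bottom sets inside the flat `G`. -/
noncomputable def UqG (p q : ℕ) (G : Finset α) : Finset (Finset α) :=
  (Uq M p q).filter (fun B => B ⊆ G)

variable {M}

/-- Membership in `Uq`. -/
theorem mem_Uq {p q : ℕ} {B : Finset α} :
    B ∈ Uq M p q ↔ B ⊆ gr M ∧ M.eRk (B : Set α) = (q : ℕ∞) ∧ M.eRk ((gr M \ B : Finset α) : Set α) = (p : ℕ∞) := by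
  unfold Uq
  simp only [Finset.mem_filter, Finset.mem_powerset]

omit [DecidableEq α] in
/-- Membership in `flatsQ`. -/
theorem mem_flatsQ {q : ℕ} {G : Finset α} :
    G ∈ flatsQ M q ↔ G ⊆ gr M ∧ M.IsFlat (G : Set α) ∧ M.eRk (G : Set α) = (q : ℕ∞) := by
  unfold flatsQ
  simp only [Finset.mem_filter, Finset.mem_powerset]

omit [DecidableEq α] in
/-- The rank-`2` flats are the `lines` of `RankLevelSetHCore.lean`. -/
theorem flatsQ_two : flatsQ M 2 = lines M := by
  ext L
  rw [mem_flatsQ, mem_lines]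
  rfl

omit [DecidableEq α] in
/-- The rank-`3` flats are the `planes` of `PlaneCore.lean`. -/
theorem flatsQ_three : flatsQ M 3 = planes M := by
  ext G
  rw [mem_flatsQ, mem_planes]
  rfl

/-- The closure of a bottom set is a rank-`q` flat. -/
theorem clF_mem_flatsQ {p q : ℕ} {B : Finset α} (hB : B ∈ Uq M p q) : clF M B ∈ flatsQ M q := by
  rw [mem_Uq] at hB
  rw [mem_flatsQ, ← Finset.coe_subset, coe_clF, coe_gr]
  exact ⟨M.closure_subset_ground _, M.isFlat_closure _, by rw [M.eRk_closure_eq, hB.2.1]⟩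

/-- A bottom set lies in its closure. -/
theorem subset_clF {p q : ℕ} {B : Finset α} (hB : B ∈ Uq M p q) : B ⊆ clF M B := by
  rw [mem_Uq] at hB
  rw [← Finset.coe_subset, coe_clF]
  exact M.subset_closure _ (by rw [← coe_gr]; exact_mod_cast hB.1)

/-- Every bottom set lies in some rank-`q` flat (its closure): `#Uq ≤ Σ_G #UqG(G)`. -/
theorem card_Uq_le (p q : ℕ) : (Uq M p q).card ≤ ∑ G ∈ flatsQ M q, (UqG M p q G).card := by
  classical
  rw [Finset.card_eq_sum_card_fiberwise (f := fun B => clF M B) (t := flatsQ M q)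
    (fun B hB => clF_mem_flatsQ hB)]
  apply Finset.sum_le_sum
  intro G _
  apply Finset.card_le_card
  intro B hB
  rw [Finset.mem_filter] at hB
  unfold UqG
  rw [Finset.mem_filter]
  exact ⟨hB.1, hB.2 ▸ subset_clF hB.1⟩

/-- **The per-flat transfer.**  A weighting `w` of the rank-`q` flats by the middle-level sets with
`Σ_G w G S ≤ 1` on `Yq`, satisfying the per-flat inequality `c · #UqG(G) ≤ Σ_{S ∈ Yq} w G S` on every rank-`q` flat,
gives `c · #Uq ≤ #Yq`.  (Theorem N: `w` = the pair rule on lines; Theorem O: `w` = max-trace on planes.) -/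
theorem mul_card_Uq_le_of_perFlat (p q : ℕ) {c : ℚ} (hc : 0 ≤ c) (w : Finset α → Finset α → ℚ)
    (hw : ∀ S ∈ Yq M p q, ∑ G ∈ flatsQ M q, w G S ≤ 1)
    (hflat : ∀ G ∈ flatsQ M q, c * ((UqG M p q G).card : ℚ) ≤ ∑ S ∈ Yq M p q, w G S) :
    c * ((Uq M p q).card : ℚ) ≤ ((Yq M p q).card : ℚ) := by
  calc c * ((Uq M p q).card : ℚ) ≤ c * ((∑ G ∈ flatsQ M q, (UqG M p q G).card : ℕ) : ℚ) := by
        apply mul_le_mul_of_nonneg_left _ hc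
        exact_mod_cast card_Uq_le p q
    _ = ∑ G ∈ flatsQ M q, c * ((UqG M p q G).card : ℚ) := by
        push_cast
        rw [Finset.mul_sum]
    _ ≤ ∑ G ∈ flatsQ M q, ∑ S ∈ Yq M p q, w G S := Finset.sum_le_sum (fun G hG => hflat G hG)
    _ = ∑ S ∈ Yq M p q, ∑ G ∈ flatsQ M q, w G S := Finset.sum_comm
    _ ≤ ∑ S ∈ Yq M p q, (1 : ℚ) := Finset.sum_le_sum (fun S hS => hw S hS)
    _ = ((Yq M p q).card : ℚ) := by simp

/-- The `U(p, q)` set-builder of `C025` is at most `#Uq` (complementation `A ↦ E ∖ A`). -/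
theorem ncard_U_le_card_Uq (M : Matroid α) [M.Finite] (p q : ℕ) :
    {A : Set α | A ⊆ M.E ∧ M.eRk A = (p : ℕ∞) ∧ M.eRk (M.E \ A) = (q : ℕ∞)}.ncard ≤ (Uq M p q).card := by
  classical
  rw [ncard_family_eq_card M (fun A => M.eRk A = (p : ℕ∞) ∧ M.eRk (M.E \ A) = (q : ℕ∞))]
  refine Finset.card_le_card_of_injOn (fun A => gr M \ A) ?_ ?_
  · intro A hA
    simp only [Finset.mem_coe, Finset.mem_filter, Finset.mem_powerset] at hA
    obtain ⟨hAE, hAp, hAq⟩ := hA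
    rw [Finset.mem_coe, mem_Uq]
    refine ⟨Finset.sdiff_subset, ?_, ?_⟩
    · rw [Finset.coe_sdiff, coe_gr, hAq]
    · rw [Finset.sdiff_sdiff_eq_self hAE, hAp]
  · intro A hA A' hA' h
    simp only [Finset.mem_coe, Finset.mem_filter, Finset.mem_powerset] at hA hA'
    simp only at h
    rw [← Finset.sdiff_sdiff_eq_self hA.1, ← Finset.sdiff_sdiff_eq_self hA'.1, h]

omit [DecidableEq α] in
/-- The `Y(p, q)` set-builder of `C025` counts `Yq`. -/
theorem ncard_Y_eq_card_Yq (M : Matroid α) [M.Finite] (p q : ℕ) :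
    {A : Set α | A ⊆ M.E ∧ (q : ℕ∞) < M.eRk A ∧ M.eRk A < (p : ℕ∞)}.ncard = (Yq M p q).card := by
  classical
  rw [ncard_family_eq_card M (fun A => (q : ℕ∞) < M.eRk A ∧ M.eRk A < (p : ℕ∞))]
  unfold Yq
  congr 1

/-- **C-025's core from a per-flat certificate**, in the spelling of `C025`: any nonnegative weighting of the rank-`q`
flats with `Σ_G w G S ≤ 1` on the middle level and the per-flat inequality with constant `c` gives
`c · #{A ⊆ E : ρ(A) = p, ρ(E ∖ A) = q} ≤ #{A ⊆ E : q < ρ(A) < p}`. -/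
theorem c025_of_perFlat (M : Matroid α) [M.Finite] (p q : ℕ) {c : ℚ} (hc : 0 ≤ c)
    (w : Finset α → Finset α → ℚ)
    (hw : ∀ S ∈ Yq M p q, ∑ G ∈ flatsQ M q, w G S ≤ 1)
    (hflat : ∀ G ∈ flatsQ M q, c * ((UqG M p q G).card : ℚ) ≤ ∑ S ∈ Yq M p q, w G S) :
    c * ({A : Set α | A ⊆ M.E ∧ M.eRk A = (p : ℕ∞) ∧ M.eRk (M.E \ A) = (q : ℕ∞)}.ncard : ℚ) ≤
      ({A : Set α | A ⊆ M.E ∧ (q : ℕ∞) < M.eRk A ∧ M.eRk A < (p : ℕ∞)}.ncard : ℚ) := by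
  rw [ncard_Y_eq_card_Yq]
  calc c * ({A : Set α | A ⊆ M.E ∧ M.eRk A = (p : ℕ∞) ∧ M.eRk (M.E \ A) = (q : ℕ∞)}.ncard : ℚ)
      ≤ c * ((Uq M p q).card : ℚ) := by
        apply mul_le_mul_of_nonneg_left _ hc
        exact_mod_cast ncard_U_le_card_Uq M p q
    _ ≤ ((Yq M p q).card : ℚ) := mul_card_Uq_le_of_perFlat p q hc w hw hflat

omit [DecidableEq α] in
/-- A NORMALIZED weighting `f G S / Σ_{G' ∈ flatsQ} f G' S` (e.g. mine-2's soft max-trace `f = θ^{|S ∩ G| − q}`) sums to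
at most `1` over the rank-`q` flats (exactly `1` when the denominator is positive, `0` when it vanishes). -/
theorem sum_normalized_le_one (q : ℕ) (f : Finset α → Finset α → ℚ) (hf : ∀ G S, 0 ≤ f G S) (S : Finset α) :
    ∑ G ∈ flatsQ M q, f G S / ∑ G' ∈ flatsQ M q, f G' S ≤ 1 := by
  rw [← Finset.sum_div]
  by_cases h : (∑ G' ∈ flatsQ M q, f G' S) = 0
  · rw [h, div_zero]
    exact zero_le_one
  · have hpos : 0 < ∑ G' ∈ flatsQ M q, f G' S :=
      lt_of_le_of_ne (Finset.sum_nonneg (fun G _ => hf G S)) (Ne.symm h)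
    rw [div_le_one hpos]

/-- **C-025's core from a normalized per-flat certificate**: for any nonnegative `f`, if every rank-`q` flat `G` satisfies
`c · #UqG(G) ≤ Σ_{S ∈ Yq} f G S / Σ_{G'} f G' S`, then `c · #U(p, q) ≤ #Y(p, q)` — the hypothesis `Σ_G w ≤ 1` of
`c025_of_perFlat` is automatic for normalized rules. -/
theorem c025_of_perFlat_normalized (M : Matroid α) [M.Finite] (p q : ℕ) {c : ℚ} (hc : 0 ≤ c)
    (f : Finset α → Finset α → ℚ) (hf : ∀ G S, 0 ≤ f G S)
    (hflat : ∀ G ∈ flatsQ M q,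
      c * ((UqG M p q G).card : ℚ) ≤ ∑ S ∈ Yq M p q, f G S / ∑ G' ∈ flatsQ M q, f G' S) :
    c * ({A : Set α | A ⊆ M.E ∧ M.eRk A = (p : ℕ∞) ∧ M.eRk (M.E \ A) = (q : ℕ∞)}.ncard : ℚ) ≤
      ({A : Set α | A ⊆ M.E ∧ (q : ℕ∞) < M.eRk A ∧ M.eRk A < (p : ℕ∞)}.ncard : ℚ) :=
  c025_of_perFlat M p q hc (fun G S => f G S / ∑ G' ∈ flatsQ M q, f G' S)
    (fun S _ => sum_normalized_le_one q f hf S) hflat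

end PerFlat

end PercRepro
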